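import Summits.QuantumFields.BalabanUV.T4Continuum.Support.NE7ApeCurvedRepRoadBGradientSharp
import HarnessLib

/-!
# NE7ApeCurvedRepRoadBGradientM — F123b AT THE NATURAL RADIUS `R = M = L^{j+1}`: the smallness line `16dM·2d(M+1)x + 32dM(e^{4α_E} − 1) ≤ 1` is IMPLIED by the regime lines F115
# already carries (`hbx : 23040d⁴(frameC+d)²M²x ≤ 1`, `hσ0 : 4(3+12d)²Mα₀ ≤ ρ₀²`, `hα₀ : α_E + … ≤ α₀`), so the curved (APE) with a datum on road (B) reads: E′'s regime + regime lines +
# the class's (1.9)-TYPE radii `j_U, j_W` + (L2) — with the gradient member displayed at Bałaban's order `α₁^Z = 4(dα_E∕M + M(j_U + j_W + dK + 2(b₀+3c_RE b₀))) +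
# (4M(8d(e^{4α_E}−1)x + 10dx + 2δ_M + 12da_M²) + 4a_M)α_E + 2xα_E`, `a_M = 2d(M+1)x`, `δ_M = 2d²(M+1)x₁ + 8d³(M+1)²x²`; file 54c

Cell `pub-balaban`, rung (B)+1 sub-cell t4, lineage `b2b-balaban-t4-ne7-p1` (CRUX PROVER NE7 #1 = OWNER of row NE7), generation 79; memo `t4/b2b-balaban-t4-ne7-p1-g79/GRADIENT-LETTER.md` §4.
File F123c (over F123b `NE7ApeCurvedRepRoadBGradientSharp.smallField_of_tanCritical_roadB_gradientSharp`; `B7Prop1Explicit.exp4_sub_one_le`, `BlockAverageVaryDisc` (`rho0`, `two_le_nbRad`),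
`NE3.SupRegularityCurvedUniform.one_le_frameC_add`).
WHY.  F123b displays a free radius `R` and one smallness line; the bootstrap reads it at `R = M`.  There `16dM·2d(M+1)x ≤ 64d²·M²x ≤ 64∕(23040·d²(frameC+d)²) ≤ 1∕2` by `hbx`, and
`32dM(e^{4α_E}−1) ≤ 256d·Mα_E ≤ 256d·Mα₀ ≤ 64d∕(3+12d)² ≤ 1∕2` by `hα₀`, `hσ0` (`ρ₀ = 1∕(128·nbRad) ≤ 1∕256`) and `e^{4α_E} − 1 ≤ 8α_E` (`α_E ≤ α₀ ≤ 1∕(4(3+12d)²) < 1∕64`).  So NO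
smallness hypothesis is added to F115's: the gradient letter is discharged into the class radii `j_U, j_W` alone.
WHAT ([folklore]; 0 def, 0 sorry).  **`smallField_of_tanCritical_roadB_gradientM`** — F123b with `R := L^{j+1}` (displayed as `((L ^ (j + 1) : ℕ) : ℝ)`) and `hR`, `hsmall` derived.
HONEST FRAMING (page 1): instantiation + real arithmetic; (L2), `j_U`, `j_W` HYPOTHESES; nothing of Bałaban's asserted; (APE) on curved data NOT proved unconditionally; NOT ONE-STEP, NOT NE7;
spine 0∕9; finite T⁴ rung (B)+1 — NOT infinite volume, NOT mass gap, NOT `BetaPertH`, NOT Clay.  Continuum YM on T⁴ ⇐ BetaPertH ∧ nine spine estimates (0/9 proved); BetaPertH ⇐ (D1) ∧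
(D4) ∧ CAP+tail; G-an2-4 gates asym, D1 and NE2/3/4.
-/
set_option autoImplicit false

open scoped BigOperators Matrix Matrix.Norms.L2Operator
open NormedSpace Finset

namespace Summit.QuantumFields.BalabanUV.T4Continuum.NE7ApeCurvedRepRoadBGradientM

open Literature.MathematicalPhysics.QuantumFieldTheory.Balaban1983to89
open B7Prop1Explicit B7Prop2Explicit MatrixLog UnitaryModel
open T4AveragingDeficitWall (Ad IsUnitaryCfg IsSkewDir SmallField vary curlAt dirL1)
open T4AveragingDeficitWallBoundary (IsPeriodicCfg periodBox)
open AveragingDeficitPeriodicCounting (IsPeriodicDir)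
open AveragingDeficitTwoLevelPrep (twoLevelSmall)
open AveragingDeficitMultiLevelPrep (cavgIter LevelSmall)
open MinimalActionLevels (perWin)
open BlockAverageVaryHolo (nbRad)
open BlockAveragePushDirGauge (gaugeDir)
open NE3HessForm (hess dAction)
open NE3TangentCovariantTower (dirIter)
open NE3EnergyShapes (IsUnitarySite IsPeriodicSite)
open NE3CovariantWeitzenbock (covDiv)
open NE3RightInverseSupLetters (frameC supC corrC)
open NE3QbarIterCovLiftPrep (cruxC)
open NE3RightInverseSolveLetters (thetaLoc)
open NE3HatInvCurlLetters (curl1C)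
open BlockAverageVaryDisc (rho0 two_le_nbRad)
open NE3LinearisedAverageSup (curvSum)
open NE3.SupRegularityCurvedUniform (one_le_frameC_add)
open NE7ApeCurvedRepRoadBGradientSharp (smallField_of_tanCritical_roadB_gradientSharp)

noncomputable section

variable {d : ℕ} {n : Type*} [Fintype n] [DecidableEq n]

/-- **ROAD (B) WITH THE GRADIENT LETTER DISCHARGED AT `R = M`** (statement in the module docstring). [folklore] -/
theorem smallField_of_tanCritical_roadB_gradientM [Nonempty n] (hd : 2 ≤ d) {L N : ℕ} [NeZero N] (hL : 2 ≤ L) (j : ℕ)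
    -- the background
    {W : Site d → Fin d → (Matrix n n ℂ)ˣ} {x : ℝ} (hWu : IsUnitaryCfg W) (hWP : IsPeriodicCfg W ((N * L ^ (j + 1) : ℕ) : ℤ))
    (hx : 0 ≤ x) (hs : LevelSmall d L j x) (hWx : SmallField W x)
    -- the sup radius of the representative and the regime at `x′ = x + 4(e^{α₀} − 1)`
    {α₀ : ℝ} (hα0 : 0 ≤ α₀) (hs' : LevelSmall d L j (x + 4 * (Real.exp α₀ - 1)))
    (hθ : cruxC d L * (((L : ℝ) ^ (j + 1)) ^ 2 * (x + 4 * (Real.exp α₀ - 1))) < 1)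
    (hθl : thetaLoc d L * (((L : ℝ) ^ (j + 1)) ^ 2 * (x + 4 * (Real.exp α₀ - 1))) < 1)
    (hε : ((L : ℝ) ^ (j + 1)) ^ 2 * (x + 4 * (Real.exp α₀ - 1)) ≤ 1)
    -- the field: of the class, tangent-critical, over `W`'s datum
    {U : Site d → Fin d → (Matrix n n ℂ)ˣ} (hUu : IsUnitaryCfg U) (hUP : IsPeriodicCfg U ((N * L ^ (j + 1) : ℕ) : ℤ))
    {xU : ℝ} (hxU : 0 ≤ xU) (hsU : LevelSmall d L j xU) (hUxU : SmallField U xU)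
    (hcritU : ∀ Y : Site d → Fin d → Matrix n n ℂ, IsSkewDir Y → IsPeriodicDir Y ((N * L ^ (j + 1) : ℕ) : ℤ) →
      dirIter L (j + 1) U Y = 0 → dAction U Y (perWin d (N * L ^ (j + 1))) = 0)
    (hTopUW : cavgIter L (j + 1) U = cavgIter L (j + 1) W)
    -- row NE3's class data of `W` and E′'s initial gauge ∕ regime (as in `exists_landauRep_W`), the constant `c_RE` named; road (B)'s two extra regime lines
    {x₁ : ℝ} (hx10 : 0 ≤ x₁)
    (hgrad : ∀ (p : Site d) (μ κ : Fin d), κ ≠ μ →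
      ‖Ad (W p μ) ((hol W (p + e μ) (plaqWord κ μ) : (Matrix n n ℂ)ˣ) : Matrix n n ℂ) - ((hol W p (plaqWord κ μ) : (Matrix n n ℂ)ˣ) : Matrix n n ℂ)‖ ≤ x₁)
    (hbx : 23040 * (d : ℝ) ^ 4 * (frameC d L + d) ^ 2 * ((L : ℝ) ^ (j + 1)) ^ 2 * x ≤ 1)
    (hcx : 11520 * (d : ℝ) ^ 4 * (frameC d L + d) ^ 3 * ((L : ℝ) ^ (j + 1)) ^ 3 * x₁ ≤ 1)
    (hbx' : 256 * (d : ℝ) ^ 2 * ((L : ℝ) ^ (j + 1)) ^ 2 * x ≤ 1) (hcx' : 16 * (d : ℝ) * ((L : ℝ) ^ (j + 1)) ^ 3 * x₁ ≤ 1)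
    {r₀ b₀ : ℝ} (hr₀ : ∀ (y : Site d) (μ : Fin d), ‖(((W y μ)⁻¹ * U y μ : (Matrix n n ℂ)ˣ) : (Matrix n n ℂ)) - 1‖ ≤ r₀)
    (hb₀ : ∀ x : Site d, ‖covDiv W (fun y μ => mlog (((W y μ)⁻¹ * U y μ : (Matrix n n ℂ)ˣ) : (Matrix n n ℂ))) x‖ ≤ b₀)
    {cRE : ℝ} (hcRE : cRE = 1 + 2 * (Fintype.card n : ℝ) * (64 * (d : ℝ) ^ 2 * N) ^ d + 27 * (Fintype.card n : ℝ) ^ 3 * (512 : ℝ) ^ d * (N : ℝ) ^ d)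
    (hreg₁ : (36 * (d : ℝ) * (frameC d L + d) ^ 2) * ((L : ℝ) ^ (j + 1)) ^ 2 * (cRE * b₀) ≤ 1 / 10)
    (hreg₂ : (36 * (d : ℝ) * (frameC d L + d)) * (L : ℝ) ^ (j + 1) * (cRE * b₀) ≤ 1 / 25)
    (hreg₃ : r₀ + 5 / 2 * ((36 * (d : ℝ) * (frameC d L + d)) * (L : ℝ) ^ (j + 1) * (cRE * b₀)) ≤ 1 / 20)
    (hline : cRE * (4 * ((36 * (d : ℝ) * (frameC d L + d) ^ 2) * ((L : ℝ) ^ (j + 1)) ^ 2) * (b₀ + 4 * (cRE * b₀))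
        + 25 * d * (r₀ + 5 / 2 * ((36 * (d : ℝ) * (frameC d L + d)) * (L : ℝ) ^ (j + 1) * (cRE * b₀))) * ((36 * (d : ℝ) * (frameC d L + d)) * (L : ℝ) ^ (j + 1))
        + 14 * d * ((36 * (d : ℝ) * (frameC d L + d)) * (L : ℝ) ^ (j + 1)) ^ 2 * (cRE * b₀)) ≤ 1 / 2)
    -- E′'s radii named: `α_E`, `θ_u`; the tent extension's `δ = corrC∕M·2θ_u`; road (B)'s regime `α_E ≤ 1∕40`, `θ_u ≤ 1∕160`, `δ ≤ 1∕40`, `α₀ ≥ α_E + δ + 4(2θ_u+δ)(α_E+δ)`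
    {αE θu : ℝ} (hαE : αE = 2 * (r₀ + 5 / 2 * ((36 * (d : ℝ) * (frameC d L + d)) * (L : ℝ) ^ (j + 1) * (cRE * b₀))))
    (hθu : θu = 4 * ((36 * (d : ℝ) * (frameC d L + d) ^ 2) * ((L : ℝ) ^ (j + 1)) ^ 2 * (cRE * b₀)))
    (hαE40 : αE ≤ 1 / 40) (hθu160 : θu ≤ 1 / 160)
    {δ : ℝ} (hδ : δ = corrC d / (L : ℝ) ^ (j + 1) * (2 * θu)) (hδ40 : δ ≤ 1 / 40) (hα₀ : αE + δ + 4 * (2 * θu + δ) * (αE + δ) ≤ α₀)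
    -- the remaining analytic letters at `W`: (L1)′ and α₁ for the SAME-TOP structured fields of radius `α₀`, (L2), (L3) discharged
    -- (L1)′ DISCHARGED (F111): the quadratic-remainder regime, the slice `S` containing the `W`-tangent skew periodic fields, and the names `c_N = 4m`, `ν = 24·#Plane·m`
    (hs1 : LevelSmall d L (j + 1) x) (hA : curvSum d L (j + 1) x ≤ 2 / 3 * L) (hσ0 : 4 * (3 + 12 * (d : ℝ)) ^ 2 * (L : ℝ) ^ (j + 1) * α₀ ≤ rho0 d L ^ 2)
    (S : Set (Site d → Fin d → Matrix n n ℂ))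
    (hS : ∀ X : Site d → Fin d → Matrix n n ℂ, IsSkewDir X → IsPeriodicDir X ((N * L ^ (j + 1) : ℕ) : ℤ) → dirIter L (j + 1) W X = 0 → X ∈ S)
    {cN KG ν : ℝ} (hcN : cN = 4 * (supC d L / ((L : ℝ) ^ (j + 1) * (1 - cruxC d L * (((L : ℝ) ^ (j + 1)) ^ 2 * x)))
        * (4 * (3 + 12 * (d : ℝ)) ^ 3 / rho0 d L ^ 2 * ((L : ℝ) ^ (j + 1) * α₀) ^ 2)))
    (hνm : ν = 24 * (Fintype.card (T4AveragingDeficitWall.Plane d) : ℝ) * (supC d L / ((L : ℝ) ^ (j + 1) * (1 - cruxC d L * (((L : ℝ) ^ (j + 1)) ^ 2 * x)))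
        * (4 * (3 + 12 * (d : ℝ)) ^ 3 / rho0 d L ^ 2 * ((L : ℝ) ^ (j + 1) * α₀) ^ 2)))
    -- THE GRADIENT LETTER DISCHARGED at `R = M = L^{j+1}` (the smallness line follows from `hbx`, `hσ0`, `hα₀`): only the (1.9)-TYPE flux-divergence radii of `U`, `W` remain
    {jU jW : ℝ} (hjU : ∀ (ν : Fin d) (y : Site d), ‖B8Ineq132.covDiv 1 U ν y‖ ≤ jU) (hjW : ∀ (ν : Fin d) (y : Site d), ‖B8Ineq132.covDiv 1 W ν y‖ ≤ jW)
    (hG : ∀ X ∈ S, IsPeriodicDir X ((N * L ^ (j + 1) : ℕ) : ℤ) → dirIter L (j + 1) W X = 0 → ∀ g : ℝ, 0 ≤ g →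
      (∀ Y : Site d → Fin d → Matrix n n ℂ, IsSkewDir Y → IsPeriodicDir Y ((N * L ^ (j + 1) : ℕ) : ℤ) → dirIter L (j + 1) W Y = 0 →
        |hess W X Y (perWin d (N * L ^ (j + 1)))| ≤ g * dirL1 Y (periodBox (d := d) (N * L ^ (j + 1)))) →
      ∀ z μ' ν', μ' ≠ ν' → ‖curlAt W X z μ' ν'‖ ≤ KG * g)
    (hcritW : ∀ Y : Site d → Fin d → Matrix n n ℂ, IsSkewDir Y → IsPeriodicDir Y ((N * L ^ (j + 1) : ℕ) : ℤ) → dirIter L (j + 1) W Y = 0 →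
      dAction W Y (perWin d (N * L ^ (j + 1))) = 0) :
    SmallField U (x + (KG * (
        ((x + 4 * (Real.exp α₀ - 1))
            * ((curl1C d L / (1 - thetaLoc d L * (((L : ℝ) ^ (j + 1)) ^ 2 * (x + 4 * (Real.exp α₀ - 1)))))
                * (((L : ℝ) ^ (j + 1)) ^ d / ((L : ℝ) ^ (j + 1)) ^ 2))
            * (Real.exp (((L : ℝ) ^ d / L) * ((d : ℝ) * (16 * ((d : ℝ) + 1) * ((d : ℝ) + 4) * (L : ℝ) ^ 2)
                  * (1250 * ((nbRad d L : ℝ) + L) + 8 * ((d : ℝ) * L) + 2 * L)) * (2 / twoLevelSmall d L))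
                * ((L : ℝ) / (L : ℝ) ^ d) ^ j
                * (((d : ℝ) * (2 * nbRad d L + 1) ^ d) * ((2 * (d : ℝ) + 4) * (L : ℝ) ^ 2) * (2 * (L : ℝ) ^ j) * (Real.exp α₀ - 1)
                  + (17 / 8 * ((L : ℝ) ^ 2) ^ j * (x + 4 * (Real.exp α₀ - 1)))
                    * (((d : ℝ) * (2 * nbRad d L + 1) ^ d) * ((2 * (d : ℝ) + 4)
                          * (2 * (2 * L * (nbRad d L : ℝ) + 128 * ((d : ℝ) + 1) * ((d : ℝ) + 4) * (L : ℝ) ^ 2)))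
                      + ((d : ℝ) * (2 * nbRad d L + 1) ^ d) * ((2 * (d : ℝ) + 4) * (L : ℝ) ^ 2 * (2 * (nbRad d L : ℝ))
                          + 2 * (8 * (L : ℝ) + (1250 * ((nbRad d L : ℝ) + L) + 8 * (d * L) + 2 * L))
                              * (16 * ((d : ℝ) + 1) * ((d : ℝ) + 4) * (L : ℝ) ^ 2))))))
        + (Fintype.card (T4AveragingDeficitWall.Plane d) : ℝ)
          * (2 * (240 * (Real.exp α₀ - 1) * α₀ * (2 * ((4 * ((d : ℝ) * αE / ((L ^ (j + 1) : ℕ) : ℝ) + ((L ^ (j + 1) : ℕ) : ℝ) * ((jU + jW + d * (2 * (Real.exp αE - 1) * xU + 2 * (xU * x) + 2 * (x * (2 + x) * x) + 2 * (xU * (2 + xU) * xU))) + 2 * (b₀ + 3 * (cRE * b₀)))) + (4 * ((L ^ (j + 1) : ℕ) : ℝ) * (8 * d * (Real.exp (4 * αE) - 1) * x + 10 * d * x + 2 * (2 * (d : ℝ) ^ 2 * (((L ^ (j + 1) : ℕ) : ℝ) + 1) * x₁ + 8 * (d : ℝ) ^ 3 * (((L ^ (j + 1) : ℕ) : ℝ)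 + 1) ^ 2 * x ^ 2) + 12 * d * (2 * (d : ℝ) * (((L ^ (j + 1) : ℕ) : ℝ) + 1) * x) ^ 2) + 4 * (2 * (d : ℝ) * (((L ^ (j + 1) : ℕ) : ℝ) + 1) * x)) * αE + 2 * x * αE) + 2 * δ + 2 * (4 * (2 * θu + δ) * (αE + δ))) + 24 * α₀ * (Real.exp α₀ - 1) + x) + 8 * α₀ * (2 * ((4 * ((d : ℝ) * αE / ((L ^ (j + 1) : ℕ) : ℝ) + ((L ^ (j + 1) : ℕ) : ℝ) * ((jU + jW + d * (2 * (Real.exp αE - 1) * xU + 2 * (xU * x) + 2 * (x * (2 + x) * x) + 2 * (xU * (2 + xU) * xU))) + 2 * (b₀ + 3 * (cRE * b₀)))) + (4 * ((L ^ (j + 1) : ℕ) : ℝ) * (8 * d * (Real.exp (4 * αE) - 1) * x + 10 * d * x + 2 * (2 * (d : ℝ) ^ 2 * (((L ^ (j + 1) : ℕ) : ℝ) + 1) * x₁ + 8 * (d : ℝ) ^ 3 * (((L ^ (j + 1) : ℕ) : ℝ) + 1) ^ 2 * x ^ 2) + 12 * d * (2 * (d : ℝ) * (((L ^ (j + 1)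 : ℕ) : ℝ) + 1) * x) ^ 2) + 4 * (2 * (d : ℝ) * (((L ^ (j + 1) : ℕ) : ℝ) + 1) * x)) * αE + 2 * x * αE) + 2 * δ + 2 * (4 * (2 * θu + δ) * (αE + δ))) + 24 * α₀ * (Real.exp α₀ - 1))
              + 6 * (Real.exp α₀ - 1) * (2 * ((4 * ((d : ℝ) * αE / ((L ^ (j + 1) : ℕ) : ℝ) + ((L ^ (j + 1) : ℕ) : ℝ) * ((jU + jW + d * (2 * (Real.exp αE - 1) * xU + 2 * (xU * x) + 2 * (x * (2 + x) * x) + 2 * (xU * (2 + xU) * xU))) + 2 * (b₀ + 3 * (cRE * b₀)))) + (4 * ((L ^ (j + 1) : ℕ) : ℝ) * (8 * d * (Real.exp (4 * αE) - 1) * x + 10 * d * x + 2 * (2 * (d : ℝ) ^ 2 * (((L ^ (j + 1) : ℕ) : ℝ) + 1) * x₁ + 8 * (d : ℝ) ^ 3 * (((L ^ (j + 1) : ℕ) : ℝ) + 1) ^ 2 * x ^ 2) + 12 * d * (2 * (d : ℝ) * (((L ^ (j + 1) : ℕ) : ℝ) + 1) * x) ^ 2) + 4 * (2 * (d : ℝ)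 * (((L ^ (j + 1) : ℕ) : ℝ) + 1) * x)) * αE + 2 * x * αE) + 2 * δ + 2 * (4 * (2 * θu + δ) * (αE + δ))) + 24 * (Real.exp α₀ - 1) * α₀)
              + (2 * ((4 * ((d : ℝ) * αE / ((L ^ (j + 1) : ℕ) : ℝ) + ((L ^ (j + 1) : ℕ) : ℝ) * ((jU + jW + d * (2 * (Real.exp αE - 1) * xU + 2 * (xU * x) + 2 * (x * (2 + x) * x) + 2 * (xU * (2 + xU) * xU))) + 2 * (b₀ + 3 * (cRE * b₀)))) + (4 * ((L ^ (j + 1) : ℕ) : ℝ) * (8 * d * (Real.exp (4 * αE) - 1) * x + 10 * d * x + 2 * (2 * (d : ℝ) ^ 2 * (((L ^ (j + 1) : ℕ) : ℝ) + 1) * x₁ + 8 * (d : ℝ) ^ 3 * (((L ^ (j + 1) : ℕ) : ℝ) + 1) ^ 2 * x ^ 2) + 12 * d * (2 * (d : ℝ) * (((L ^ (j + 1) : ℕ) : ℝ) + 1) * x) ^ 2) + 4 * (2 * (d : ℝ) * (((L ^ (j + 1) : ℕ) : ℝ) + 1) * x)) * αE + 2 * x * αE) + 2 * δ + 2 * (4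 * (2 * θu + δ) * (αE + δ))) + 24 * (Real.exp α₀ - 1) * α₀) * (2 * ((4 * ((d : ℝ) * αE / ((L ^ (j + 1) : ℕ) : ℝ) + ((L ^ (j + 1) : ℕ) : ℝ) * ((jU + jW + d * (2 * (Real.exp αE - 1) * xU + 2 * (xU * x) + 2 * (x * (2 + x) * x) + 2 * (xU * (2 + xU) * xU))) + 2 * (b₀ + 3 * (cRE * b₀)))) + (4 * ((L ^ (j + 1) : ℕ) : ℝ) * (8 * d * (Real.exp (4 * αE) - 1) * x + 10 * d * x + 2 * (2 * (d : ℝ) ^ 2 * (((L ^ (j + 1) : ℕ) : ℝ) + 1) * x₁ + 8 * (d : ℝ) ^ 3 * (((L ^ (j + 1) : ℕ) : ℝ) + 1) ^ 2 * x ^ 2) + 12 * d * (2 * (d : ℝ) * (((L ^ (j + 1) : ℕ) : ℝ) + 1) * x) ^ 2) + 4 * (2 * (d : ℝ) * (((L ^ (j + 1) : ℕ) : ℝ) + 1) * x)) * αE + 2 * x * αE) + 2 * δ + 2 * (4 * (2 * θu + δ) * (αE + δ))) + 24 * α₀ * (Real.exp α₀ - 1))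
              + 960 * (Real.exp α₀ - 1) * α₀ ^ 2 + 32 * x * α₀ ^ 2)
            + (64 * α₀ * ((4 * ((d : ℝ) * αE / ((L ^ (j + 1) : ℕ) : ℝ) + ((L ^ (j + 1) : ℕ) : ℝ) * ((jU + jW + d * (2 * (Real.exp αE - 1) * xU + 2 * (xU * x) + 2 * (x * (2 + x) * x) + 2 * (xU * (2 + xU) * xU))) + 2 * (b₀ + 3 * (cRE * b₀)))) + (4 * ((L ^ (j + 1) : ℕ) : ℝ) * (8 * d * (Real.exp (4 * αE) - 1) * x + 10 * d * x + 2 * (2 * (d : ℝ) ^ 2 * (((L ^ (j + 1) : ℕ) : ℝ) + 1) * x₁ + 8 * (d : ℝ) ^ 3 * (((L ^ (j + 1) : ℕ) : ℝ) + 1) ^ 2 * x ^ 2) + 12 * d * (2 * (d : ℝ) * (((L ^ (j + 1) : ℕ) : ℝ) + 1) * x) ^ 2) + 4 * (2 * (d : ℝ) * (((L ^ (j + 1) : ℕ) : ℝ) + 1) * x)) * αE + 2 * x * αE) + 2 * δ + 2 * (4 * (2 * θu + δ) * (αE + δ))) + 1024 * x * α₀ ^ 2))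
        + ν) + cN + 28 * α₀ ^ 2)) := by
  have hd1 : 1 ≤ d := by omega
  have hM1 : 1 ≤ L ^ (j + 1) := Nat.one_le_pow _ _ (by omega)
  -- the smallness line at `R = M` from `hbx`, `hσ0`, `hα₀`
  have hsmall : 16 * (d : ℝ) * (L ^ (j + 1) : ℕ) * (2 * (d : ℝ) * ((L ^ (j + 1) : ℕ) + 1) * x)
      + 32 * (d : ℝ) * (L ^ (j + 1) : ℕ) * (Real.exp (4 * αE) - 1) ≤ 1 := by
    rw [Nat.cast_pow]
    have hM : (1 : ℝ) ≤ (L : ℝ) ^ (j + 1) := by exact_mod_cast hM1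
    have hd : (1 : ℝ) ≤ d := by exact_mod_cast hd1
    have hF := one_le_frameC_add (d := d) hd1 L
    -- signs
    have hb0 : 0 ≤ b₀ := (norm_nonneg _).trans (hb₀ 0)
    have hr0 : 0 ≤ r₀ := (norm_nonneg _).trans (hr₀ 0 ⟨0, by omega⟩)
    have hfr : 0 ≤ frameC d L := by unfold frameC; positivity
    have hc0 : 0 ≤ corrC d := zero_le_one.trans (NE3RightInverseSupLetters.one_le_corrC d)
    have hcRE0 : 0 ≤ cRE := by rw [hcRE]; positivity
    have hθu0 : 0 ≤ θu := by rw [hθu]; positivity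
    have hαE0 : 0 ≤ αE := by rw [hαE]; positivity
    have hδ0 : 0 ≤ δ := by rw [hδ]; positivity
    -- (a) the curvature part: `32d²M(M+1)x ≤ 64d²M²x ≤ 1∕2`
    have hM2x : 23040 * ((d : ℝ) ^ 4 * (frameC d L + d) ^ 2) * (((L : ℝ) ^ (j + 1)) ^ 2 * x) ≤ 1 := by nlinarith only [hbx]
    have hd2 : (1 : ℝ) ≤ (d : ℝ) ^ 2 := one_le_pow₀ hd
    have hF2 : (1 : ℝ) ≤ (frameC d L + d) ^ 2 := one_le_pow₀ hF
    have hdF : (1 : ℝ) ≤ (d : ℝ) ^ 4 * (frameC d L + d) ^ 2 := one_le_mul_of_one_le_of_one_le (one_le_pow₀ hd) hF2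
    have hM2x' : ((L : ℝ) ^ (j + 1)) ^ 2 * x ≤ 1 / 23040 := by
      have h0 : 0 ≤ ((L : ℝ) ^ (j + 1)) ^ 2 * x := by positivity
      nlinarith only [hM2x, hdF, h0]
    have ha : 16 * (d : ℝ) * (L : ℝ) ^ (j + 1) * (2 * (d : ℝ) * ((L : ℝ) ^ (j + 1) + 1) * x) ≤ 1 / 2 := by
      have h1 : 16 * (d : ℝ) * (L : ℝ) ^ (j + 1) * (2 * (d : ℝ) * ((L : ℝ) ^ (j + 1) + 1) * x) ≤ 64 * (d : ℝ) ^ 2 * (((L : ℝ) ^ (j + 1)) ^ 2 * x) := by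
        have h2 : (L : ℝ) ^ (j + 1) + 1 ≤ 2 * (L : ℝ) ^ (j + 1) := by linarith only [hM]
        have h3 : 0 ≤ 32 * (d : ℝ) ^ 2 * (L : ℝ) ^ (j + 1) * x := by positivity
        nlinarith only [h2, h3]
      have h4 : 64 * (d : ℝ) ^ 2 * (((L : ℝ) ^ (j + 1)) ^ 2 * x) ≤ 1 / 2 := by
        have h5 : (d : ℝ) ^ 2 * (((L : ℝ) ^ (j + 1)) ^ 2 * x) ≤ (d : ℝ) ^ 4 * (frameC d L + d) ^ 2 * (((L : ℝ) ^ (j + 1)) ^ 2 * x) := by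
          have h6 : (d : ℝ) ^ 2 ≤ (d : ℝ) ^ 4 * (frameC d L + d) ^ 2 := by
            have h7 : (d : ℝ) ^ 2 ≤ (d : ℝ) ^ 4 := by
              rw [show (4 : ℕ) = 2 + 2 from rfl, pow_add]; exact le_mul_of_one_le_right (by positivity) hd2
            exact h7.trans (le_mul_of_one_le_right (by positivity) hF2)
          exact mul_le_mul_of_nonneg_right h6 (by positivity)
        nlinarith only [hM2x, h5]
      linarith only [h1, h4]
    -- (b) the representative part: `32dM(e^{4α_E} − 1) ≤ 256d·Mα₀ ≤ 64d∕(3+12d)² ≤ 1∕2`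
    have hαEα0 : αE ≤ α₀ := by
      have h1 : 0 ≤ δ + 4 * (2 * θu + δ) * (αE + δ) := by positivity
      linarith only [hα₀, h1]
    have hrho : rho0 d L ^ 2 ≤ 1 := by
      have hn : (2 : ℝ) ≤ nbRad d L := by exact_mod_cast two_le_nbRad (d := d) (by omega : 1 ≤ L)
      have hr1 : rho0 d L ≤ 1 := by
        unfold rho0
        rw [div_le_one (by positivity)]
        linarith only [hn]
      have hr0 : 0 ≤ rho0 d L := by unfold rho0; positivity
      nlinarith only [hr1, hr0]
    have hMα : 4 * (3 + 12 * (d : ℝ)) ^ 2 * ((L : ℝ) ^ (j + 1) * α₀) ≤ 1 := by nlinarith only [hσ0, hrho]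
    have hαE64 : αE ≤ 1 / 64 := by
      have h1 : αE ≤ (L : ℝ) ^ (j + 1) * α₀ := hαEα0.trans (by nlinarith only [hM, hα0])
      have h2 : (225 : ℝ) ≤ (3 + 12 * (d : ℝ)) ^ 2 := by nlinarith only [hd]
      have h3 : 0 ≤ (L : ℝ) ^ (j + 1) * α₀ := by positivity
      nlinarith only [h1, hMα, h2, h3]
    have hexp := exp4_sub_one_le hαE0 hαE64
    have hb : 32 * (d : ℝ) * (L : ℝ) ^ (j + 1) * (Real.exp (4 * αE) - 1) ≤ 1 / 2 := by
      have h1 : 32 * (d : ℝ) * (L : ℝ) ^ (j + 1) * (Real.exp (4 * αE) - 1) ≤ 256 * (d : ℝ) * ((L : ℝ) ^ (j + 1) * α₀) := by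
        have h2 : 0 ≤ 32 * (d : ℝ) * (L : ℝ) ^ (j + 1) := by positivity
        nlinarith only [hexp, hαEα0, h2]
      have h3 : 256 * (d : ℝ) * ((L : ℝ) ^ (j + 1) * α₀) ≤ 1 / 2 := by
        -- `128d ≤ (3+12d)²`
        have h4 : 128 * (d : ℝ) ≤ (3 + 12 * (d : ℝ)) ^ 2 := by nlinarith only [hd]
        have h5 : 0 ≤ (L : ℝ) ^ (j + 1) * α₀ := by positivity
        nlinarith only [hMα, h4, h5]
      linarith only [h1, h3]
    linarith only [ha, hb]
  exact smallField_of_tanCritical_roadB_gradientSharp hd hL j hWu hWP hx hs hWx hα0 hs' hθ hθl hε hUu hUP hxU hsU hUxU hcritU hTopUW hx10 hgrad hbx hcx hbx' hcx'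
    hr₀ hb₀ hcRE hreg₁ hreg₂ hreg₃ hline hαE hθu hαE40 hθu160 hδ hδ40 hα₀ hs1 hA hσ0 S hS hcN hνm hM1 hsmall hjU hjW hG hcritW

end

end Summit.QuantumFields.BalabanUV.T4Continuum.NE7ApeCurvedRepRoadBGradientM
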